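import Summits.FinalStateConjecture.FinalStateConjecture.Theses.PhaseMixingCapture
import Literature.Geometry.Lorentzian.TameGenericityDiagonal

/-!
# Sketch (ideator 2, round 1) — crux `CaptureSufficesTame` (stmt-FinalStateConjecture-17270)
# card `only-the-third-law-is-generic`

First lemmas of the card, all `lean check`ed:

* `CensoredExteriorsSettleC0`, `SubextremalUpgradeC0C2` — VERBATIM the bodies of the sibling items
  stmt-FinalStateConjecture-17296 (`GlobalAttraction.CensoredExteriorsSettle` =
  `TwoBoundarySqueeze.SqueezeToKerrFamilyC0`) and stmt-FinalStateConjecture-17298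
  (`GlobalAttraction.SubextremalUpgrade` = `TwoBoundarySqueeze.SubextremalUpgradeC2`): pointwise, all
  censored data, C⁰ level (extremal endpoints allowed) / pointwise upgrade at sub-extremal endpoints.
* `RelativeThirdLaw` — the ONE new statement: the third law (un-parking) as a RELATIVE witness
  statement along tame curves of CENSORED data (the `hrel` shape of
  `InitialDataSet.isTameChristodoulouGeneric_of_relative'`), members handed back being censored with
  only sub-extremal honest C⁰ endpoint configurations (= the property of item 17297
  `GenericCensorshipThirdLaw`, which GlobalAttraction must file MONOLITHICALLY with censorship).
* `finalStateConjecture_of_relativeThirdLaw` (PROVED): tame censorship (the crux's h₃) +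
  17296 + RelativeThirdLaw + 17298 ⟹ the re-typed summit; NO `MGHDExists` (item 9937) needed.
* `captureSufficesTame_of_relativeThirdLaw` (PROVED): hence the crux BY NAME (h₁, h₂ introduced and
  dropped — idle under the tame re-typing, see the card's F1).
* `no_firstOrder_transversality` (PROVED): a non-negative functional vanishing at a parked member
  has zero derivative there — the extremality defect `M_f² − |J_f|` can never be crossed
  transversally at first order; `fold_witness` (PROVED): the second-order (FOLD) shape that does give
  tame witnesses along the steep diagonal `s = K c`.
-/

-- the doubled `FinalStateConjecture.FinalStateConjecture` path component trips dupNamespace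
set_option linter.dupNamespace false

noncomputable section

open scoped Manifold ContDiff Topology ENNReal
open Set Function Filter

namespace Summit.FinalStateConjecture.FinalStateConjecture.Cruxes.CaptureSufficesTame.Ideator2

open Literature.Geometry.Lorentzian
open Summit.FinalStateConjecture.FinalStateConjecture.Theses.PhaseMixingCapture
  (NearExtremalKappaCapture BulkKerrCaptureC2 WeakCosmicCensorshipTame CaptureSufficesTame)

/-! ## §1 The shared pointwise C⁰ trio (verbatim sibling items) and the one new relative item -/

/-- VERBATIM body of item stmt-FinalStateConjecture-17296 (`GlobalAttraction.CensoredExteriorsSettle`,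
`TwoBoundarySqueeze.SqueezeToKerrFamilyC0`): every censored MGHD of every admissible datum carries an
HONEST C⁰ final-state decomposition (extremal endpoints `|aᵢ| ≤ Mᵢ` allowed). Pointwise, no genericity. -/
def CensoredExteriorsSettleC0 : Prop :=
  ∀ (X : Type) [TopologicalSpace X] [ChartedSpace Literature.Geometry.Lorentzian.E3 X] [IsManifold (𝓡 3) ((⊤ : ℕ∞) : WithTop ℕ∞) X] [T2Space X] [SecondCountableTopology X] [ConnectedSpace X], ∀ D ∈ Literature.Geometry.Lorentzian.admissibleVacuumData X, ∀ 𝒟 : Literature.Geometry.Lorentzian.VacuumCauchyDevelopment D, 𝒟.IsMaximal → Summit.FinalStateConjecture.HasCompleteNullInfinity 𝒟.toCauchyDevelopment → ∃ (O : Set 𝒟.carrier) (d : Literature.Geometry.Lorentzian.FinalStateDecomposition 𝒟.toSpacetime O 0), O = Summit.FinalStateConjecture.exteriorOf 𝒟.toCauchyDevelopment d.charted ∧ Summit.FinalStateConjecture.RaysStayInClosure 𝒟.toCauchyDevelopment O ∧ Summit.FinalStateConjecture.HasExhaustiveCharts d ∧ Summit.FinalStateConjecture.IsFutureOriented d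

/-- VERBATIM body of item stmt-FinalStateConjecture-17298 (`GlobalAttraction.SubextremalUpgrade`,
`TwoBoundarySqueeze.SubextremalUpgradeC2`): an honest C⁰ endpoint configuration with SUB-extremal holes
of a censored MGHD upgrades to the summit's honest C² decomposition. Pointwise, no genericity. -/
def SubextremalUpgradeC0C2 : Prop :=
  ∀ (X : Type) [TopologicalSpace X] [ChartedSpace Literature.Geometry.Lorentzian.E3 X] [IsManifold (𝓡 3) ((⊤ : ℕ∞) : WithTop ℕ∞) X] [T2Space X] [SecondCountableTopology X] [ConnectedSpace X], ∀ D ∈ Literature.Geometry.Lorentzian.admissibleVacuumData X, ∀ 𝒟 : Literature.Geometry.Lorentzian.VacuumCauchyDevelopment D, 𝒟.IsMaximal → Summit.FinalStateConjecture.HasCompleteNullInfinity 𝒟.toCauchyDevelopment → ∀ (O : Set 𝒟.carrier) (d₀ : Literature.Geometry.Lorentzian.FinalStateDecomposition 𝒟.toSpacetime O 0), O = Summit.FinalStateConjecture.exteriorOf 𝒟.toCauchyDevelopment d₀.charted → Summit.FinalStateConjecture.RaysStayInClosure 𝒟.toCauchyDevelopment O → Summit.FinalStateConjecture.HasExhaustiveCharts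 d₀ → Summit.FinalStateConjecture.IsFutureOriented d₀ → (∀ i, Literature.Geometry.Lorentzian.Kerr.IsSubextremal (d₀.mass i) (d₀.spin i)) → ∃ (O' : Set 𝒟.carrier) (d : Literature.Geometry.Lorentzian.FinalStateDecomposition 𝒟.toSpacetime O' 2), (∀ i, Literature.Geometry.Lorentzian.Kerr.IsSubextremal (d.mass i) (d.spin i)) ∧ O' = Summit.FinalStateConjecture.exteriorOf 𝒟.toCauchyDevelopment d.charted ∧ Summit.FinalStateConjecture.RaysStayInClosure 𝒟.toCauchyDevelopment O' ∧ Summit.FinalStateConjecture.HasExhaustiveCharts d ∧ Summit.FinalStateConjecture.IsFutureOriented d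

section Properties

variable {X : Type} [TopologicalSpace X] [ChartedSpace E3 X] [IsManifold (𝓡 3) ∞ X] [T2Space X]
  [SecondCountableTopology X] [ConnectedSpace X]

/-- The censorship matrix of the crux's hypothesis `WeakCosmicCensorshipTame` (verbatim): an MGHD exists
and every MGHD has complete future null infinity. -/
def Censored (D : InitialDataSet (𝓡 3) X) : Prop :=
  (∃ 𝒟 : VacuumCauchyDevelopment D, 𝒟.IsMaximal) ∧
    ∀ 𝒟 : VacuumCauchyDevelopment D, 𝒟.IsMaximal →
      Summit.FinalStateConjecture.HasCompleteNullInfinity 𝒟.toCauchyDevelopment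

/-- The third-law property (verbatim the matrix of item 17297 `GenericCensorshipThirdLaw`): every MGHD
has complete 𝓘⁺ and every HONEST C⁰ endpoint configuration of it has only sub-extremal holes. -/
def ThirdLawProperty (D : InitialDataSet (𝓡 3) X) : Prop :=
  ∀ 𝒟 : VacuumCauchyDevelopment D, 𝒟.IsMaximal →
    Summit.FinalStateConjecture.HasCompleteNullInfinity 𝒟.toCauchyDevelopment ∧
      ∀ (O : Set 𝒟.carrier) (d : FinalStateDecomposition 𝒟.toSpacetime O 0),
        O = Summit.FinalStateConjecture.exteriorOf 𝒟.toCauchyDevelopment d.charted →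
          Summit.FinalStateConjecture.RaysStayInClosure 𝒟.toCauchyDevelopment O →
            Summit.FinalStateConjecture.HasExhaustiveCharts d →
              Summit.FinalStateConjecture.IsFutureOriented d →
                ∀ i, Kerr.IsSubextremal (d.mass i) (d.spin i)

/-- The summit's own matrix (verbatim the property inside `FinalStateConjecture`). -/
def SummitProperty (D : InitialDataSet (𝓡 3) X) : Prop :=
  (∃ 𝒟 : VacuumCauchyDevelopment D, 𝒟.IsMaximal) ∧
    ∀ 𝒟 : VacuumCauchyDevelopment D, 𝒟.IsMaximal →
      Summit.FinalStateConjecture.HasCompleteNullInfinity 𝒟.toCauchyDevelopment ∧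
        ∃ (O : Set 𝒟.carrier) (d : FinalStateDecomposition 𝒟.toSpacetime O 2),
          (∀ i, Kerr.IsSubextremal (d.mass i) (d.spin i)) ∧
            O = Summit.FinalStateConjecture.exteriorOf 𝒟.toCauchyDevelopment d.charted ∧
              Summit.FinalStateConjecture.RaysStayInClosure 𝒟.toCauchyDevelopment O ∧
                Summit.FinalStateConjecture.HasExhaustiveCharts d ∧
                  Summit.FinalStateConjecture.IsFutureOriented d

end Properties

/-- **The one new item: the THIRD LAW RIDES CENSORED CURVES (relative, tame).** For every end `e` and
every tame admissible curve `F` (immersed-injective, or constant) whose members off `0` are CENSORED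
(base datum arbitrary), there is a tame, injective, immersed admissible curve `F'` through the same base
datum whose members off `0` are censored AND satisfy the third-law property (every honest C⁰ endpoint
configuration of every MGHD is sub-extremal). Shape = the `hrel` hypothesis of
`InitialDataSet.isTameChristodoulouGeneric_of_relative'` with `Q := Censored`, `P := Censored ∧ ThirdLaw`.
Intended engine: the second-order FOLD `G(c, s)` (kick of size `s` on member `c`, §3) read along the
steep diagonal `s = Kc`. -/
def RelativeThirdLaw : Prop :=
  ∀ (X : Type) [TopologicalSpace X] [ChartedSpace E3 X] [IsManifold (𝓡 3) ∞ X] [T2Space X]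
    [SecondCountableTopology X] [ConnectedSpace X],
    ∀ (e : AFEnd X) (F : EuclideanSpace ℝ (Fin 1) → InitialDataSet (𝓡 3) X),
      InitialDataSet.IsTameDataFamily e 1 F →
        ((InitialDataSet.IsImmersedAtZero 1 F ∧ Function.Injective F) ∨ ∀ c, F c = F 0) →
        (∀ c, F c ∈ admissibleVacuumData X) →
        (∀ c ≠ 0, Censored (F c)) →
        ∃ (e' : AFEnd X) (F' : EuclideanSpace ℝ (Fin 1) → InitialDataSet (𝓡 3) X),
          InitialDataSet.IsTameDataFamily e' 1 F' ∧ F' 0 = F 0 ∧ Function.Injective F' ∧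
            InitialDataSet.IsImmersedAtZero 1 F' ∧ (∀ c, F' c ∈ admissibleVacuumData X) ∧
            ∀ c ≠ 0, Censored (F' c) ∧ ThirdLawProperty (F' c)

/-! ## §2 The transfer, proved: `17296 ∧ RelativeThirdLaw ∧ 17298 ⟹ CaptureSufficesTame` -/

/-- Pointwise key step (GlobalAttraction's `key`, minus `MGHDExists`: the MGHD comes from censorship):
a censored datum with the third-law property satisfies the summit's matrix, by the pointwise C⁰
attraction `hA` and the pointwise upgrade `hU`. -/
theorem summitProperty_of_censored_thirdLaw (hA : CensoredExteriorsSettleC0) (hU : SubextremalUpgradeC0C2)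
    {X : Type} [TopologicalSpace X] [ChartedSpace E3 X] [IsManifold (𝓡 3) ∞ X] [T2Space X]
    [SecondCountableTopology X] [ConnectedSpace X]
    {D : InitialDataSet (𝓡 3) X} (hD : D ∈ admissibleVacuumData X) (hQ : Censored D)
    (hT : ThirdLawProperty D) : SummitProperty D := by
  refine ⟨hQ.1, fun 𝒟 hmax ↦ ⟨hQ.2 𝒟 hmax, ?_⟩⟩
  obtain ⟨O, d, hO, hRay, hExh, hFut⟩ := hA X D hD 𝒟 hmax (hQ.2 𝒟 hmax)
  exact hU X D hD 𝒟 hmax (hQ.2 𝒟 hmax) O d hO hRay hExh hFut ((hT 𝒟 hmax).2 O d hO hRay hExh hFut)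

/-- **The re-typed summit from tame censorship + the shared pointwise trio + the relative third law.**
`hW` is VERBATIM the crux's third hypothesis `WeakCosmicCensorshipTame`. One application of the
composition of tame genericities along curves, one `mono`. No `MGHDExists`. [folklore] -/
theorem finalStateConjecture_of_relativeThirdLaw (hW : WeakCosmicCensorshipTame)
    (hA : CensoredExteriorsSettleC0) (hR : RelativeThirdLaw) (hU : SubextremalUpgradeC0C2) :
    _root_.FinalStateConjecture := by
  intro X _ _ _ _ _ _
  have h𝓓 : ∀ d ∈ admissibleVacuumData X,
      ∃ e : AFEnd X, e.IsSoleEnd ∧ ∃ M : ℝ, e.IsStronglyAsymptoticallyFlatDR d M :=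
    fun d hd ↦ exists_isSoleEnd_of_mem_admissibleVacuumData hd
  -- tame-generic (censored ∧ third law): composition along CENSORED curves (censorship is GIVEN)
  have gT : InitialDataSet.IsTameChristodoulouGeneric (admissibleVacuumData X)
      (fun D ↦ Censored D ∧ ThirdLawProperty D) 1 :=
    InitialDataSet.isTameChristodoulouGeneric_of_relative' h𝓓 (hW X) (hR X)
  -- pointwise upgrade to the summit's matrix
  exact gT.mono fun D hD hDT ↦ summitProperty_of_censored_thirdLaw hA hU hD hDT.1 hDT.2

/-- **THE CRUX BY NAME.** `CaptureSufficesTame` from the shared pointwise trio and the relative third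
law; the two capture hypotheses are introduced and dropped (idle under the tame re-typing: tame witness
members are globally small perturbations of the base datum, so the Cauchy-typed captures can be
consumed neither at time zero nor — old light — later). [folklore] -/
theorem captureSufficesTame_of_relativeThirdLaw (hA : CensoredExteriorsSettleC0) (hR : RelativeThirdLaw)
    (hU : SubextremalUpgradeC0C2) : CaptureSufficesTame :=
  fun _ _ hW ↦ finalStateConjecture_of_relativeThirdLaw hW hA hR hU

/-- Sanity (necessity of the new item's pointwise half): the summit implies that every tame-generic…
— rather, the cheap direction available in-tree: the summit's matrix implies censorship. -/
example {X : Type} [TopologicalSpace X] [ChartedSpace E3 X] [IsManifold (𝓡 3) ∞ X] [T2Space X]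
    [SecondCountableTopology X] [ConnectedSpace X]
    {D : InitialDataSet (𝓡 3) X} (h : SummitProperty D) : Censored D :=
  ⟨h.1, fun 𝒟 hmax ↦ (h.2 𝒟 hmax).1⟩

/-! ## §3 The engine's ORDER: first-order transversality is impossible; the fold gives witnesses -/

/-- **No first-order transversality at a parked member.** If `Φ ≥ 0` (think: the extremality defect
`M_f² − |J_f|` of a final hole read along a kick `s ↦ G(c₀, s)`) and `Φ 0 = 0` (the member is parked),
then `deriv Φ 0 = 0`: a parked member is a minimum, the wall cannot be crossed transversally — the
witness mechanism is necessarily SECOND order. (Mathlib: `IsLocalMin.deriv_eq_zero`; no differentiability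
hypothesis is needed, `deriv` being `0` off the differentiable locus.) [folklore] -/
theorem no_firstOrder_transversality {Φ : ℝ → ℝ} (hnonneg : ∀ s, 0 ≤ Φ s) (h0 : Φ 0 = 0) :
    deriv Φ 0 = 0 := by
  have hmin : IsLocalMin Φ 0 := Filter.Eventually.of_forall fun s ↦ by rw [h0]; exact hnonneg s
  exact hmin.deriv_eq_zero

/-- **Fold witness along the steep diagonal.** If along the two-parameter unfolding the defect obeys the
FOLD lower bound `α (s − σ c)² ≤ Φ c s` (`α > 0`; `σ` = the parked locus, a graph over `c` through the
origin with `|σ c| ≤ L |c|`), then for every slope `K > L` the diagonal members `s = K c`, `c ≠ 0`, are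
strictly un-parked: `0 < Φ c (K c)`. This is the shape in which `RelativeThirdLaw` hands back its curve
`F' c := G(c, Kc)` (tame as the composite of a tame unfolding with a linear map,
`IsTameDataFamily.comp_contDiff`). [folklore] -/
theorem fold_witness {Φ : ℝ → ℝ → ℝ} {σ : ℝ → ℝ} {α L K : ℝ} (hα : 0 < α) (hL : 0 ≤ L)
    (hKL : L < K) (hσ : ∀ c, |σ c| ≤ L * |c|) (hfold : ∀ c s, α * (s - σ c) ^ 2 ≤ Φ c s) :
    ∀ c ≠ 0, 0 < Φ c (K * c) := by
  intro c hc
  have hK : 0 ≤ K := hL.trans hKL.le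
  have h1 : (K - L) * |c| ≤ |K * c - σ c| := by
    have h := abs_sub_abs_le_abs_sub (K * c) (σ c)
    rw [abs_mul, abs_of_nonneg hK] at h
    nlinarith [hσ c, abs_nonneg c]
  have h2 : 0 < |K * c - σ c| :=
    lt_of_lt_of_le (mul_pos (sub_pos.mpr hKL) (abs_pos.mpr hc)) h1
  have h3 : 0 < (K * c - σ c) ^ 2 := by
    rw [sq, ← abs_mul_abs_self]
    exact mul_pos h2 h2
  exact lt_of_lt_of_le (mul_pos hα h3) (hfold c (K * c))

/-- The parked locus of a fold through a parked base point passes through the origin: if `Φ 0 · ≥ 0`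
attains `0` at `s = 0` and the fold bound holds at `c = 0`, then `σ 0 = 0` (so `|σ c| ≤ L|c|` is the
honest Lipschitz-graph condition, not an extra normalisation). [folklore] -/
theorem fold_locus_through_origin {Φ : ℝ → ℝ → ℝ} {σ : ℝ → ℝ} {α : ℝ} (hα : 0 < α)
    (hfold : ∀ s, α * (s - σ 0) ^ 2 ≤ Φ 0 s) (h00 : Φ 0 0 = 0) : σ 0 = 0 := by
  have h := hfold 0
  rw [h00, zero_sub] at h
  have hsq : (-σ 0) ^ 2 = 0 := le_antisymm (by nlinarith [sq_nonneg (-σ 0)]) (sq_nonneg _)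
  simpa using pow_eq_zero_iff (n := 2) (by norm_num) |>.mp hsq

end Summit.FinalStateConjecture.FinalStateConjecture.Cruxes.CaptureSufficesTame.Ideator2

end
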